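import Literature.Topology.FourManifolds.SurfaceGroupHomologyMoveBlocks
import Mathlib.RingTheory.Coprime.Lemmas
import Mathlib.Tactic.LinearCombination
import Mathlib.Tactic.NormNum
import HarnessLib

/-!
# Helper III for stub `stub_goeritzRealisationThree` (line `nilpotent-genus-class`, crux
`CongruenceShadows.ShadowApproximation`, item stmt-SmoothPoincare4-14595): reduction of the integral
pair-stabiliser to its elementary generators

Pure linear algebra over `ℤ` on `H₁ = (surfaceGen 3 → ℤ)` (letters `a₀,b₀,a₁,b₁,a₂,b₂`, intersection
form `ν = symplForm`, `ν(aᵢ,bᵢ) = 1`).  Let `Λ₀ = ⟨a₀,a₁,b₂⟩` and `Λ₁ = ⟨a₀,b₁,a₂⟩` (the coordinate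
Lagrangians of the standard genus-`3` Heegaard splitting of `S¹×S²`; in coordinates `v ∈ Λ₀` iff
`v(b₀) = v(b₁) = v(a₂) = 0`).  **Theorem (assembled in the stub file as `mem_of_stabiliser`).** Every
isometry `F` of `ν` with `F(Λ₀) ⊆ Λ₀`, `F(Λ₁) ⊆ Λ₁` lies in any subgroup `R ≤ GL(H₁)` containing the
elementary moves `moveX 0 c` (`b₀ ↦ b₀ + c a₀`), `moveW 0 1 c`, `moveW 0 2 c`, `moveW 1 2 c`
(`bᵢ ↦ bᵢ + c aⱼ`, `bⱼ ↦ bⱼ + c aᵢ`), `moveZ 0 1 c`, `moveZ 0 2 c` (`aⱼ ↦ aⱼ + c a₀`, `b₀ ↦ b₀ - c bⱼ`),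
a lower unipotent `E c` (`a₁ ↦ a₁ + c b₂`, `a₂ ↦ a₂ + c b₁`) and the three handle signs `N k`
(`a_k, b_k ↦ -a_k, -b_k`) — `E` and `N` enter only through their coordinate formulas (hypotheses
`hE`, `hN`), so that this file does not depend on where they are defined.

Proof = normal form, step by step (each step multiplies `F` on the left by elements of `R`):
(1) `F a₀ ∈ Λ₀ ∩ Λ₁ = ℤa₀` and `ν(F a₀, F b₀) = 1` force `F a₀ = ±a₀`; the sign `N 0` makes it `a₀`.
(2) Write `F a₁ = α a₀ + p a₁ + q b₂`; `ν(F a₁, F b₁) = 1` makes `(p, q)` coprime, and EUCLID's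
algorithm with `moveW 1 2 c` (`p ↦ p + c q`) and `E c` (`q ↦ q + c p`), finished by the sign `N 1`,
reaches `(p, q) = (1, 0)` (`euclid`, induction on `|q|`).  (3) Then `F b₂ = β a₀ + t a₁ + s b₂` with
`s = ±1` (`ν(F b₂, F a₂) = -1`); `N 2` and `moveW 1 2 (-t)` give `(t, s) = (0, 1)` (`col_two`).
(4) `moveZ 0 1 (-α)` and `moveW 0 2 (-β)` kill `α, β`: now `F` fixes `a₀, a₁, b₂` (`fix_three`).
(5) RIGIDITY: an isometry in the stabiliser fixing `a₀, a₁, b₂` is `moveX 0 c₀ · moveW 0 1 γ ·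
moveZ 0 2 δ` with `c₀, γ, δ` read off from `F b₀, F b₁, F a₂` — step (5) and the final assembly are
carried out in the stub file `…StubGoeritzRealisationThree.lean`; this file provides steps (1)–(4)
(`apply_a0_eq`, `euclid`, `col_two`, `fix_three`) and the generator bookkeeping (`inQ_*`).
Everything is elementary; no definitions (the predicates are file-local notations). [folklore]
-/

-- the prescribed namespace `Summit.<P>.<Sub>.…` duplicates `SmoothPoincare4` (P = Sub)
set_option linter.dupNamespace false
noncomputable section
open Literature.Topology.FourManifolds Multiplicative

namespace Summit.SmoothPoincare4.SmoothPoincare4.Theorems.ShadowApproximation.NilpotentGenusClass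

/-! ## Notation -/

local notation "H₁" => surfaceGen 3 → ℤ
local notation "𝔞₀" => (((0 : Fin 3), false) : surfaceGen 3)
local notation "𝔟₀" => (((0 : Fin 3), true) : surfaceGen 3)
local notation "𝔞₁" => (((1 : Fin 3), false) : surfaceGen 3)
local notation "𝔟₁" => (((1 : Fin 3), true) : surfaceGen 3)
local notation "𝔞₂" => (((2 : Fin 3), false) : surfaceGen 3)
local notation "𝔟₂" => (((2 : Fin 3), true) : surfaceGen 3)
local notation "δ[" x "]" => (Pi.single x (1 : ℤ) : surfaceGen 3 → ℤ)

/-- `InL0⟪v⟫`: `v ∈ Λ₀ = ⟨a₀,a₁,b₂⟩`, in coordinates. -/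
local notation3 "InL0⟪" v "⟫" => (v : H₁) 𝔟₀ = 0 ∧ (v : H₁) 𝔟₁ = 0 ∧ (v : H₁) 𝔞₂ = 0
/-- `InL1⟪v⟫`: `v ∈ Λ₁ = ⟨a₀,b₁,a₂⟩`, in coordinates. -/
local notation3 "InL1⟪" v "⟫" => (v : H₁) 𝔟₀ = 0 ∧ (v : H₁) 𝔞₁ = 0 ∧ (v : H₁) 𝔟₂ = 0
/-- `InP⟪F⟫`: `F` is an isometry of `ν` mapping `Λ₀` into `Λ₀` and `Λ₁` into `Λ₁`. -/
local notation3 "InP⟪" F "⟫" =>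
  (∀ u v : H₁, symplForm ((F : H₁ ≃ₗ[ℤ] H₁) u) ((F : H₁ ≃ₗ[ℤ] H₁) v) = symplForm u v) ∧
    (∀ v : H₁, InL0⟪v⟫ → InL0⟪(F : H₁ ≃ₗ[ℤ] H₁) v⟫) ∧
    (∀ v : H₁, InL1⟪v⟫ → InL1⟪(F : H₁ ≃ₗ[ℤ] H₁) v⟫)
/-- `InQ⟪F⟫`: `InP⟪F⟫` and `F a₀ = a₀`. -/
local notation3 "InQ⟪" F "⟫" => InP⟪F⟫ ∧ (F : H₁ ≃ₗ[ℤ] H₁) δ[𝔞₀] = δ[𝔞₀]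

/-! ## Coordinates -/

/-- The intersection form at genus `3`, written out. [folklore] -/
theorem symplForm_three (v w : H₁) : symplForm v w =
    v 𝔞₀ * w 𝔟₀ - v 𝔟₀ * w 𝔞₀ + (v 𝔞₁ * w 𝔟₁ - v 𝔟₁ * w 𝔞₁) + (v 𝔞₂ * w 𝔟₂ - v 𝔟₂ * w 𝔞₂) := by
  rw [symplForm_apply, Fin.sum_univ_three]

/-- Two vectors of `H₁` with the same six coordinates are equal. [folklore] -/
theorem vec_ext {v w : H₁} (h0 : v 𝔞₀ = w 𝔞₀) (h1 : v 𝔟₀ = w 𝔟₀) (h2 : v 𝔞₁ = w 𝔞₁)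
    (h3 : v 𝔟₁ = w 𝔟₁) (h4 : v 𝔞₂ = w 𝔞₂) (h5 : v 𝔟₂ = w 𝔟₂) : v = w := by
  funext ⟨i, b⟩
  fin_cases i <;> cases b <;> assumption

/-- Two linear automorphisms of `H₁` agreeing on the six basis vectors are equal. [folklore] -/
theorem linearEquiv_ext {F G : H₁ ≃ₗ[ℤ] H₁} (h : ∀ x : surfaceGen 3, F δ[x] = G δ[x]) : F = G := by
  refine LinearEquiv.toLinearMap_injective (LinearMap.pi_ext fun x n => ?_)
  have e : (Pi.single x n : H₁) = n • δ[x] := by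
    rw [← Pi.single_smul, smul_eq_mul, mul_one]
  simp only [LinearEquiv.coe_coe, e, map_smul, h x]

section Reduction

variable (E : ℤ → (H₁ ≃ₗ[ℤ] H₁)) (N : Fin 3 → (H₁ ≃ₗ[ℤ] H₁))
  (hE : ∀ (c : ℤ) (v : H₁), E c v = v + c • (Pi.single 𝔟₂ (v 𝔞₁) + Pi.single 𝔟₁ (v 𝔞₂)))
  (hN : ∀ (k : Fin 3) (v : H₁) (x : surfaceGen 3), N k v x = if x.1 = k then -v x else v x)

/-! ## The generators lie in the stabiliser -/

/-- Products stay in the stabiliser. [folklore] -/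
theorem inP_mul {F G : H₁ ≃ₗ[ℤ] H₁} (hF : InP⟪F⟫) (hG : InP⟪G⟫) : InP⟪F * G⟫ := by
  refine ⟨fun u v => ?_, fun v hv => ?_, fun v hv => ?_⟩
  · rw [linearEquiv_mul_apply, linearEquiv_mul_apply, hF.1, hG.1]
  · rw [linearEquiv_mul_apply]; exact hF.2.1 _ (hG.2.1 v hv)
  · rw [linearEquiv_mul_apply]; exact hF.2.2 _ (hG.2.2 v hv)

/-- Products stay in the stabiliser of `a₀`. [folklore] -/
theorem inQ_mul {F G : H₁ ≃ₗ[ℤ] H₁} (hF : InQ⟪F⟫) (hG : InQ⟪G⟫) : InQ⟪F * G⟫ :=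
  ⟨inP_mul hF.1 hG.1, by rw [linearEquiv_mul_apply, hG.2, hF.2]⟩

/-- `moveW 1 2 c` lies in the stabiliser and fixes `a₀`. [folklore] -/
theorem inQ_moveW12 (c : ℤ) : InQ⟪moveW 1 2 c⟫ := by
  have h12 : (1 : Fin 3) ≠ 2 := by decide
  refine ⟨⟨fun u v => symplForm_moveW h12 c u v, fun v hv => ?_, fun v hv => ?_⟩, ?_⟩
  · rw [moveW_apply_true, moveW_apply_true, moveW_apply_false_right h12, hv.1, hv.2.1, hv.2.2]
    simp
  · rw [moveW_apply_true, moveW_apply_true, moveW_apply_false_left h12, hv.1, hv.2.1, hv.2.2]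
    simp
  · exact moveW_eq_self c (by simp) (by simp)

/-- `moveW 0 2 c` lies in the stabiliser and fixes `a₀`. [folklore] -/
theorem inQ_moveW02 (c : ℤ) : InQ⟪moveW 0 2 c⟫ := by
  have h02 : (0 : Fin 3) ≠ 2 := by decide
  refine ⟨⟨fun u v => symplForm_moveW h02 c u v, fun v hv => ?_, fun v hv => ?_⟩, ?_⟩
  · rw [moveW_apply_true, moveW_apply_true, moveW_apply_false_right h02, hv.1, hv.2.1, hv.2.2]
    simp
  · rw [moveW_apply_true, moveW_apply_true, moveW_apply_of_ne 0 2 c v (by simp) (by simp), hv.1,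
      hv.2.1, hv.2.2]
    simp
  · exact moveW_eq_self c (by simp) (by simp)

/-- `moveZ 0 1 c` lies in the stabiliser and fixes `a₀`. [folklore] -/
theorem inQ_moveZ01 (c : ℤ) : InQ⟪moveZ 0 1 (by decide) c⟫ := by
  have h01 : (0 : Fin 3) ≠ 1 := by decide
  refine ⟨⟨fun u v => symplForm_moveZ h01 c u v, fun v hv => ?_, fun v hv => ?_⟩, ?_⟩
  · rw [moveZ_apply_true, moveZ_apply_of_ne h01 c v (by simp) (by simp),
      moveZ_apply_of_ne h01 c v (by simp) (by simp), hv.1, hv.2.1, hv.2.2]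
    simp
  · rw [moveZ_apply_of_ne h01 c v (by simp) (by simp), moveZ_apply_of_ne h01 c v (by simp) (by simp),
      moveZ_apply_of_ne h01 c v (by simp) (by simp), hv.1, hv.2.1, hv.2.2]
    simp
  · exact moveZ_eq_self h01 c (by simp) (by simp)

include hE in
/-- `E c` is an isometry. [folklore] -/
theorem symplForm_E (c : ℤ) (u v : H₁) : symplForm (E c u) (E c v) = symplForm u v := by
  rw [symplForm_three, symplForm_three, hE, hE]
  simp
  ring

include hE in
/-- `E c` lies in the stabiliser and fixes `a₀`. [folklore] -/
theorem inQ_E (c : ℤ) : InQ⟪E c⟫ := by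
  refine ⟨⟨symplForm_E E hE c, fun v hv => ?_, fun v hv => ?_⟩, ?_⟩
  · rw [hE]; simp [hv.1, hv.2.1, hv.2.2]
  · rw [hE]; simp [hv.1, hv.2.1, hv.2.2]
  · rw [hE]; simp

include hN in
/-- `N k` is an isometry. [folklore] -/
theorem symplForm_N (k : Fin 3) (u v : H₁) : symplForm (N k u) (N k v) = symplForm u v := by
  rw [symplForm_three, symplForm_three]
  simp only [hN]
  fin_cases k <;> simp

include hN in
/-- `N k` lies in the stabiliser. [folklore] -/
theorem inP_N (k : Fin 3) : InP⟪N k⟫ := by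
  refine ⟨symplForm_N N hN k, fun v hv => ?_, fun v hv => ?_⟩
  · simp only [hN]
    exact ⟨by split_ifs <;> simp [hv.1], by split_ifs <;> simp [hv.2.1], by split_ifs <;> simp [hv.2.2]⟩
  · simp only [hN]
    exact ⟨by split_ifs <;> simp [hv.1], by split_ifs <;> simp [hv.2.1], by split_ifs <;> simp [hv.2.2]⟩

include hN in
/-- `N k` fixes `a₀` for `k ≠ 0`. [folklore] -/
theorem inQ_N {k : Fin 3} (hk : k ≠ 0) : InQ⟪N k⟫ := by
  refine ⟨inP_N N hN k, ?_⟩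
  funext x
  rw [hN]
  split_ifs with h
  · rw [Pi.single_eq_of_ne (fun e => hk (by rw [← h, e])), neg_zero]
  · rfl

include hN in
/-- `N 0` negates `a₀`. [folklore] -/
theorem N_zero_single : N 0 δ[𝔞₀] = -δ[𝔞₀] := by
  funext x
  rw [hN, Pi.neg_apply]
  split_ifs with h
  · rfl
  · rw [Pi.single_eq_of_ne (fun e => h (by rw [e])), neg_zero]

/-! ## Step 1: `F a₀ = ±a₀` -/

/-- In the stabiliser, `F a₀ = ±a₀` (`F a₀ ∈ Λ₀ ∩ Λ₁ = ℤa₀` and `ν(F a₀, F b₀) = 1`). [folklore] -/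
theorem apply_a0_eq {F : H₁ ≃ₗ[ℤ] H₁} (hF : InP⟪F⟫) : F δ[𝔞₀] = δ[𝔞₀] ∨ F δ[𝔞₀] = -δ[𝔞₀] := by
  obtain ⟨hb0, hb1, ha2⟩ := hF.2.1 δ[𝔞₀] ⟨by simp, by simp, by simp⟩
  obtain ⟨-, ha1, hb2⟩ := hF.2.2 δ[𝔞₀] ⟨by simp, by simp, by simp⟩
  have hνab : symplForm (F δ[𝔞₀]) (F δ[𝔟₀]) = 1 := by rw [hF.1]; simp
  rw [symplForm_three, hb0, hb1, ha2, ha1, hb2] at hνab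
  have hp : F δ[𝔞₀] 𝔞₀ * F δ[𝔟₀] 𝔟₀ = 1 := by linear_combination hνab
  rcases Int.eq_one_or_neg_one_of_mul_eq_one hp with h | h
  · left
    exact vec_ext (by simpa using h) (by simpa using hb0) (by simpa using ha1) (by simpa using hb1)
      (by simpa using ha2) (by simpa using hb2)
  · right
    exact vec_ext (by simpa using h) (by simpa using hb0) (by simpa using ha1) (by simpa using hb1)
      (by simpa using ha2) (by simpa using hb2)

/-! ## Step 2: Euclid on the first column of the Levi block -/

/-- The first column `(p, q)` of the Levi block is a primitive vector (`ν(F a₁, F b₁) = 1`). [folklore] -/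
theorem isCoprime_of_inP {F : H₁ ≃ₗ[ℤ] H₁} (hF : InP⟪F⟫) : IsCoprime (F δ[𝔞₁] 𝔞₁) (F δ[𝔞₁] 𝔟₂) := by
  obtain ⟨hb0, hb1, ha2⟩ := hF.2.1 δ[𝔞₁] ⟨by simp, by simp, by simp⟩
  obtain ⟨hb0', ha1', hb2'⟩ := hF.2.2 δ[𝔟₁] ⟨by simp, by simp, by simp⟩
  have hν : symplForm (F δ[𝔞₁]) (F δ[𝔟₁]) = 1 := by rw [hF.1]; simp
  rw [symplForm_three, hb0, hb1, ha2, hb0', ha1', hb2'] at hν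
  exact ⟨F δ[𝔟₁] 𝔟₁, -F δ[𝔟₁] 𝔞₂, by linear_combination hν⟩

/-- Effect of `moveW 1 2 c` on the first column: `p ↦ p + c q`. [folklore] -/
theorem moveW12_mul_apply_a1 (c : ℤ) (F : H₁ ≃ₗ[ℤ] H₁) (v : H₁) :
    ((moveW 1 2 c : H₁ ≃ₗ[ℤ] H₁) * F) v 𝔞₁ = F v 𝔞₁ + c * F v 𝔟₂ := by
  rw [linearEquiv_mul_apply, moveW_apply_false_left (by decide)]

/-- `moveW 1 2 c` does not move `b`-coordinates. [folklore] -/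
theorem moveW12_mul_apply_true (c : ℤ) (F : H₁ ≃ₗ[ℤ] H₁) (v : H₁) (k : Fin 3) :
    ((moveW 1 2 c : H₁ ≃ₗ[ℤ] H₁) * F) v (k, true) = F v (k, true) := by
  rw [linearEquiv_mul_apply, moveW_apply_true]

include hE in
/-- Effect of `E c` on the first column: `q ↦ q + c p`, `p` fixed. [folklore] -/
theorem E_mul_apply (c : ℤ) (F : H₁ ≃ₗ[ℤ] H₁) (v : H₁) :
    (E c * F) v 𝔞₁ = F v 𝔞₁ ∧ (E c * F) v 𝔟₂ = F v 𝔟₂ + c * F v 𝔞₁ := by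
  rw [linearEquiv_mul_apply, hE]
  simp

include hN in
/-- Effect of `N k`: the coordinates of handle `k` change sign. [folklore] -/
theorem N_mul_apply (k : Fin 3) (F : H₁ ≃ₗ[ℤ] H₁) (v : H₁) (x : surfaceGen 3) :
    (N k * F) v x = if x.1 = k then -F v x else F v x := by
  rw [linearEquiv_mul_apply, hN]

/-- Peeling a realised factor: `r ∈ R` and `r * F ∈ R` give `F ∈ R`. [folklore] -/
theorem mem_of_mul_mem {R : Subgroup (H₁ ≃ₗ[ℤ] H₁)} {r F : H₁ ≃ₗ[ℤ] H₁} (hr : r ∈ R)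
    (h : r * F ∈ R) : F ∈ R := by
  simpa using R.mul_mem (R.inv_mem hr) h

include hN in
/-- Base of Euclid: `q = 0` forces `p = ±1`, and the sign `N 1` makes it `1`. [folklore] -/
theorem euclid_base (R : Subgroup (H₁ ≃ₗ[ℤ] H₁)) (hNR : ∀ k, N k ∈ R) (F : H₁ ≃ₗ[ℤ] H₁)
    (hq : F δ[𝔞₁] 𝔟₂ = 0) (hc : IsCoprime (F δ[𝔞₁] 𝔞₁) (F δ[𝔞₁] 𝔟₂)) :
    ∃ r ∈ R, InQ⟪r⟫ ∧ (r * F) δ[𝔞₁] 𝔞₁ = 1 ∧ (r * F) δ[𝔞₁] 𝔟₂ = 0 := by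
  rw [hq, isCoprime_zero_right, Int.isUnit_iff] at hc
  rcases hc with h | h
  · exact ⟨1, R.one_mem, ⟨⟨fun u v => rfl, fun v hv => hv, fun v hv => hv⟩, rfl⟩, h, hq⟩
  · refine ⟨N 1, hNR 1, inQ_N N hN (by decide), ?_, ?_⟩
    · rw [N_mul_apply N hN, if_pos rfl, h]; decide
    · rw [N_mul_apply N hN, if_neg (by decide), hq]

include hE hN in
/-- **Euclid's algorithm on the Levi block** (induction on `|q|`): left multiplication by moves
`moveW 1 2 c`, `E c` and the sign `N 1` brings the first column `(p, q)` of the Levi block to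
`(1, 0)`. [folklore] -/
theorem euclid (R : Subgroup (H₁ ≃ₗ[ℤ] H₁)) (hW : ∀ c, moveW 1 2 c ∈ R) (hER : ∀ c, E c ∈ R)
    (hNR : ∀ k, N k ∈ R) : ∀ (n : ℕ) (F : H₁ ≃ₗ[ℤ] H₁), (F δ[𝔞₁] 𝔟₂).natAbs ≤ n →
      IsCoprime (F δ[𝔞₁] 𝔞₁) (F δ[𝔞₁] 𝔟₂) →
      ∃ r ∈ R, InQ⟪r⟫ ∧ (r * F) δ[𝔞₁] 𝔞₁ = 1 ∧ (r * F) δ[𝔞₁] 𝔟₂ = 0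
  | 0, F, hn, hc => euclid_base N hN R hNR F (Int.natAbs_eq_zero.1 (Nat.le_zero.1 hn)) hc
  | n + 1, F, hn, hc => by
      by_cases hq : F δ[𝔞₁] 𝔟₂ = 0
      · exact euclid_base N hN R hNR F hq hc
      set p := F δ[𝔞₁] 𝔞₁ with hp
      set q := F δ[𝔞₁] 𝔟₂ with hq'
      -- reduce `p` modulo `q`
      set F₁ := moveW 1 2 (-(p / q)) * F with hF₁
      have hdiv := Int.emod_add_mul_ediv p q
      have hp₁ : F₁ δ[𝔞₁] 𝔞₁ = p % q := by rw [hF₁, moveW12_mul_apply_a1]; linear_combination -hdiv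
      have hq₁ : F₁ δ[𝔞₁] 𝔟₂ = q := moveW12_mul_apply_true _ _ _ _
      have hc₁ : IsCoprime (F₁ δ[𝔞₁] 𝔞₁) (F₁ δ[𝔞₁] 𝔟₂) := by
        rw [hp₁, hq₁, show p % q = p + q * (-(p / q)) by linear_combination hdiv]
        exact hc.add_mul_left_left _
      have hQ₁ : InQ⟪moveW 1 2 (-(p / q))⟫ := inQ_moveW12 _
      by_cases hp0 : p % q = 0
      · -- `q = ±1`: two more moves finish
        rw [hp₁, hq₁, hp0, isCoprime_zero_left, Int.isUnit_iff] at hc₁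
        have hqq : q * q = 1 := by rcases hc₁ with h | h <;> rw [h] <;> norm_num
        refine ⟨E (-q) * (moveW 1 2 q * moveW 1 2 (-(p / q))),
          R.mul_mem (hER _) (R.mul_mem (hW _) (hW _)),
          inQ_mul (inQ_E E hE _) (inQ_mul (inQ_moveW12 _) hQ₁), ?_, ?_⟩
        · rw [mul_assoc, (E_mul_apply E hE _ _ _).1, mul_assoc, moveW12_mul_apply_a1, ← hF₁, hp₁,
            hq₁, hp0, zero_add, hqq]
        · rw [mul_assoc, (E_mul_apply E hE _ _ _).2, mul_assoc, moveW12_mul_apply_true,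
            moveW12_mul_apply_a1, ← hF₁, hp₁, hq₁, hp0, zero_add, hqq]
          ring
      · -- reduce `q` modulo `p % q` and recurse
        set F₂ := E (-(q / (p % q))) * F₁ with hF₂
        have hdiv₂ := Int.emod_add_mul_ediv q (p % q)
        have hp₂ : F₂ δ[𝔞₁] 𝔞₁ = p % q := by rw [hF₂, (E_mul_apply E hE _ _ _).1, hp₁]
        have hq₂ : F₂ δ[𝔞₁] 𝔟₂ = q % (p % q) := by
          rw [hF₂, (E_mul_apply E hE _ _ _).2, hp₁, hq₁]; linear_combination -hdiv₂
        have hlt : (F₂ δ[𝔞₁] 𝔟₂).natAbs ≤ n := by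
          rw [hq₂]
          have h1 := Literature.LinearAlgebra.Matrix.natAbs_emod_lt q hp0
          have h2 := Literature.LinearAlgebra.Matrix.natAbs_emod_lt p hq
          omega
        have hc₂ : IsCoprime (F₂ δ[𝔞₁] 𝔞₁) (F₂ δ[𝔞₁] 𝔟₂) := by
          rw [hp₂, hq₂, show q % (p % q) = q + (-(q / (p % q))) * (p % q) by linear_combination hdiv₂]
          rw [hp₁, hq₁] at hc₁
          exact hc₁.add_mul_right_right _
        obtain ⟨r, hr, hrQ, h1, h2⟩ := euclid R hW hER hNR n F₂ hlt hc₂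
        refine ⟨r * (E (-(q / (p % q))) * moveW 1 2 (-(p / q))),
          R.mul_mem hr (R.mul_mem (hER _) (hW _)), inQ_mul hrQ (inQ_mul (inQ_E E hE _) hQ₁), ?_, ?_⟩
        · simpa only [mul_assoc] using h1
        · simpa only [mul_assoc] using h2

/-! ## Step 3: the second column -/

include hN in
/-- With the first column `(1, 0)`, the second column `(t, s)` has `s = ±1`; the sign `N 2` and
`moveW 1 2 (-t)` make the Levi block the identity. [folklore] -/
theorem col_two (R : Subgroup (H₁ ≃ₗ[ℤ] H₁)) (hW : ∀ c, moveW 1 2 c ∈ R) (hNR : ∀ k, N k ∈ R)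
    {F : H₁ ≃ₗ[ℤ] H₁} (hF : InQ⟪F⟫) (h1 : F δ[𝔞₁] 𝔞₁ = 1) (h2 : F δ[𝔞₁] 𝔟₂ = 0) :
    ∃ r ∈ R, InQ⟪r⟫ ∧ (r * F) δ[𝔞₁] 𝔞₁ = 1 ∧ (r * F) δ[𝔞₁] 𝔟₂ = 0 ∧ (r * F) δ[𝔟₂] 𝔞₁ = 0 ∧
      (r * F) δ[𝔟₂] 𝔟₂ = 1 := by
  obtain ⟨a_b0, a_b1, a_a2⟩ := hF.1.2.1 δ[𝔞₁] ⟨by simp, by simp, by simp⟩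
  obtain ⟨c_b0, c_b1, c_a2⟩ := hF.1.2.1 δ[𝔟₂] ⟨by simp, by simp, by simp⟩
  obtain ⟨d_b0, d_a1, d_b2⟩ := hF.1.2.2 δ[𝔞₂] ⟨by simp, by simp, by simp⟩
  have hz : F δ[𝔞₂] 𝔟₁ = 0 := by
    have hν : symplForm (F δ[𝔞₁]) (F δ[𝔞₂]) = 0 := by rw [hF.1.1]; simp
    rw [symplForm_three, a_b0, a_b1, a_a2, h1, h2, d_b0, d_a1] at hν
    linear_combination hν
  have hs : F δ[𝔟₂] 𝔟₂ * F δ[𝔞₂] 𝔞₂ = 1 := by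
    have hν : symplForm (F δ[𝔟₂]) (F δ[𝔞₂]) = -1 := by rw [hF.1.1]; simp
    rw [symplForm_three, c_b0, c_b1, c_a2, d_b0, d_a1, d_b2, hz] at hν
    linear_combination -hν
  -- first fix the sign of `s`
  obtain ⟨r₁, hr₁, hr₁Q, e1, e2, e3, e4⟩ : ∃ r₁ ∈ R, InQ⟪r₁⟫ ∧ (r₁ * F) δ[𝔞₁] 𝔞₁ = 1 ∧
      (r₁ * F) δ[𝔞₁] 𝔟₂ = 0 ∧ (r₁ * F) δ[𝔟₂] 𝔞₁ = F δ[𝔟₂] 𝔞₁ ∧ (r₁ * F) δ[𝔟₂] 𝔟₂ = 1 := by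
    rcases Int.eq_one_or_neg_one_of_mul_eq_one hs with h | h
    · exact ⟨1, R.one_mem, ⟨⟨fun u v => rfl, fun v hv => hv, fun v hv => hv⟩, rfl⟩, h1, h2, rfl, h⟩
    · refine ⟨N 2, hNR 2, inQ_N N hN (by decide), ?_, ?_, ?_, ?_⟩
      · rw [N_mul_apply N hN, if_neg (by decide), h1]
      · rw [N_mul_apply N hN, if_pos rfl, h2, neg_zero]
      · rw [N_mul_apply N hN, if_neg (by decide)]
      · rw [N_mul_apply N hN, if_pos rfl, h]; decide
  refine ⟨moveW 1 2 (-F δ[𝔟₂] 𝔞₁) * r₁, R.mul_mem (hW _) hr₁, inQ_mul (inQ_moveW12 _) hr₁Q,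
    ?_, ?_, ?_, ?_⟩
  · rw [mul_assoc, moveW12_mul_apply_a1, e1, e2]; ring
  · rw [mul_assoc, moveW12_mul_apply_true, e2]
  · rw [mul_assoc, moveW12_mul_apply_a1, e3, e4]; ring
  · rw [mul_assoc, moveW12_mul_apply_true, e4]

/-! ## Step 4: fixing `a₁` and `b₂` exactly -/

/-- With the Levi block the identity, `moveZ 0 1 (-α)` and `moveW 0 2 (-β)` make `F` fix `a₁` and
`b₂` (`α, β` the `a₀`-components of `F a₁`, `F b₂`). [folklore] -/
theorem fix_three (R : Subgroup (H₁ ≃ₗ[ℤ] H₁)) (hZ01 : ∀ c, moveZ 0 1 (by decide) c ∈ R)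
    (hW02 : ∀ c, moveW 0 2 c ∈ R) {F : H₁ ≃ₗ[ℤ] H₁} (hF : InQ⟪F⟫) (h1 : F δ[𝔞₁] 𝔞₁ = 1)
    (h2 : F δ[𝔞₁] 𝔟₂ = 0) (h3 : F δ[𝔟₂] 𝔞₁ = 0) (h4 : F δ[𝔟₂] 𝔟₂ = 1) :
    ∃ r ∈ R, InQ⟪r⟫ ∧ (r * F) δ[𝔞₁] = δ[𝔞₁] ∧ (r * F) δ[𝔟₂] = δ[𝔟₂] := by
  have h01 : (0 : Fin 3) ≠ 1 := by decide
  have h02 : (0 : Fin 3) ≠ 2 := by decide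
  obtain ⟨a_b0, a_b1, a_a2⟩ := hF.1.2.1 δ[𝔞₁] ⟨by simp, by simp, by simp⟩
  obtain ⟨c_b0, c_b1, c_a2⟩ := hF.1.2.1 δ[𝔟₂] ⟨by simp, by simp, by simp⟩
  set α := F δ[𝔞₁] 𝔞₀ with hα
  set β := F δ[𝔟₂] 𝔞₀ with hβ
  refine ⟨moveW 0 2 (-β) * moveZ 0 1 h01 (-α), R.mul_mem (hW02 _) (hZ01 _),
    inQ_mul (inQ_moveW02 _) (inQ_moveZ01 _), ?_, ?_⟩
  · have hz : moveZ 0 1 h01 (-α) (F δ[𝔞₁]) = δ[𝔞₁] := by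
      refine vec_ext ?_ ?_ ?_ ?_ ?_ ?_
      · rw [moveZ_apply_false, h1]; simp [hα]
      · rw [moveZ_apply_of_ne h01 _ _ (by simp) (by simp), a_b0]; simp
      · rw [moveZ_apply_of_ne h01 _ _ (by simp) (by simp), h1]; simp
      · rw [moveZ_apply_true, a_b1, a_b0]; simp
      · rw [moveZ_apply_of_ne h01 _ _ (by simp) (by simp), a_a2]; simp
      · rw [moveZ_apply_of_ne h01 _ _ (by simp) (by simp), h2]; simp
    rw [linearEquiv_mul_apply, linearEquiv_mul_apply, hz]
    exact moveW_eq_self _ (by simp) (by simp)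
  · have hz : moveZ 0 1 h01 (-α) (F δ[𝔟₂]) = F δ[𝔟₂] :=
      moveZ_eq_self h01 _ h3 c_b0
    rw [linearEquiv_mul_apply, linearEquiv_mul_apply, hz]
    refine vec_ext ?_ ?_ ?_ ?_ ?_ ?_
    · rw [moveW_apply_false_left h02, h4]; simp [hβ]
    · rw [moveW_apply_true, c_b0]; simp
    · rw [moveW_apply_of_ne 0 2 _ _ (by simp) (by simp), h3]; simp
    · rw [moveW_apply_true, c_b1]; simp
    · rw [moveW_apply_false_right h02, c_a2, c_b0]; simp
    · rw [moveW_apply_true, h4]; simp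

end Reduction

/-! ## Registered sub-goal of this helper file -/

/-- **Registered sub-goal `goeritzThree_apply_a0`** (helper III of stub `stub_goeritzRealisationThree`,
step 1 of the reduction, notation-free): an isometry of `ν` mapping `Λ₀ = ⟨a₀,a₁,b₂⟩` into itself and
`Λ₁ = ⟨a₀,b₁,a₂⟩` into itself sends `a₀` to `±a₀`. [folklore] -/
theorem goeritzThree_apply_a0 : ∀ F : (surfaceGen 3 → ℤ) ≃ₗ[ℤ] (surfaceGen 3 → ℤ), (∀ u v : surfaceGen 3 → ℤ, symplForm (F u) (F v) = symplForm u v) → (∀ v : surfaceGen 3 → ℤ, v ((0 : Fin 3), true) = 0 ∧ v ((1 : Fin 3), true) = 0 ∧ v ((2 : Fin 3), false) = 0 → F v ((0 : Fin 3), true) = 0 ∧ F v ((1 : Fin 3), true) = 0 ∧ F v ((2 : Fin 3), false) = 0) → (∀ v : surfaceGen 3 → ℤ, v ((0 : Fin 3), true) = 0 ∧ v ((1 : Fin 3), false) = 0 ∧ v ((2 : Fin 3), true) = 0 → F v ((0 : Fin 3), true) = 0 ∧ F v ((1 : Fin 3), false) = 0 ∧ F v ((2 : Fin 3), true) = 0)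 → F (Pi.single ((0 : Fin 3), false) 1) = Pi.single ((0 : Fin 3), false) 1 ∨ F (Pi.single ((0 : Fin 3), false) 1) = -Pi.single ((0 : Fin 3), false) 1 :=
  fun _ hiso h0 h1 => apply_a0_eq ⟨hiso, h0, h1⟩

end Summit.SmoothPoincare4.SmoothPoincare4.Theorems.ShadowApproximation.NilpotentGenusClass

end
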